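import Literature.MathematicalPhysics.QuantumFieldTheory.PlaquetteChains
import Literature.MathematicalPhysics.QuantumFieldTheory.U1CoulombSheetEnergy
import Mathlib.Analysis.InnerProductSpace.Projection.Basic
import Mathlib.Analysis.InnerProductSpace.PiL2
import HarnessLib

/-!
# The finite-volume Coulomb energy of a plaquette field and the perimeter bound for the sheet

Glue file ("P5") of the proof programme of the named fact
`Literature.MathematicalPhysics.QuantumFieldTheory.FrohlichSpencerU1PerimeterLawD4`.
Fröhlich–Spencer 1982, §2.7 (2.50)–(2.52), attach to the sheet `σ` of a Wilson loop in a finite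
region `Λ` the 2-form `ε_Λ` (`dτ = σ - ε_Λ`, `ε_Λ ⊥` all closed forms), whose energy
`(ε_Λ, ε_Λ)` is the Gaussian (spin-wave) cost of the loop in the lower bound (2.88), and assert
`(ε_Λ, ε_Λ) ≤ const (L + T)` as `Λ ↗ ℤ⁴`. In the tree's closed-flux language
(`U1DualFluxEnsemble`: sums over plaquette fields `c` on `plaquettesIn Λ` with `∑ cₚ ∂p = 0`) this is
finite-dimensional Euclidean geometry, which we set up here:

* `FluxSpace Λ = EuclideanSpace ℝ (plaquettesIn Λ)`, the closed subspace
  `closedFlux Λ = {c | div₂ (fluxChain Λ c) = 0}` (`mem_closedFlux`; for integer fields this is the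
  constraint `∑ cₚ ∂p = 0`, `PlaquetteChains.div₂_fluxChain_intCast_eq_zero_iff`);
* `coulombField Λ S = S - P_{closed} S` (`ε_Λ`, the component of `S` orthogonal to the closed
  fields) and `coulombEnergy Λ S = ‖coulombField Λ S‖²` (`(ε_Λ, ε_Λ)`);
* the exact splitting `‖c + S‖² = ‖c + P S‖² + coulombEnergy Λ S` for closed `c`
  (`norm_sq_add_eq_of_mem`, in coordinates `sum_sq_add_eq_of_mem`) — the algebraic heart of the
  spin-wave/defect factorisation of the Villain model — and the variational characterisation
  `coulombEnergy Λ S ≤ ∑ₚ (cₚ + Sₚ)²` for every closed `c` (`coulombEnergy_le_sum_sq_of_mem`);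
* **`coulombEnergy_sheet_le`**: in dimension `d = n + 1 ≥ 4` there is `C` such that for every
  rectangle (`x₀`, plane `i < j`, sides `R, T ≥ 1`) the Coulomb energy of its sheet in the cube
  `{-m,…,m}^d` is `≤ C (R + T)` for all large `m` — from the infinite-volume variational bound
  `U1CoulombSheetEnergy.exists_closedChain_sheet` via the dictionary `PlaquetteChains`
  (`fluxChain_sheet`: the plaquette field `sheet` of `U1DualFluxEnsemble` is the tensor `sheetT`
  of `U1CoulombSheet`).

Everything is proved; no named fact is introduced.

## References

* J. Fröhlich, T. Spencer, Comm. Math. Phys. 83 (1982) 411–454, §2.7 (2.50)–(2.52) (`ε_Λ`),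
  §2.10 (2.88) (`(ε_Λ, ε_Λ) ≤ const (L+T)`). [FrohlichSpencerCMP1982]
-/

open Finset Function Filter Literature.Probability.LatticeModels
open Literature.Probability.LatticeModels renaming Site → ZdSite

noncomputable section

namespace Literature.MathematicalPhysics.QuantumFieldTheory

open LatticeForm (e)
open LatticeChain

variable {d : ℕ}

/-! ### Linearity of `div₂` -/

namespace LatticeChain

/-- `div₂` is additive. [folklore] -/
theorem div₂_add (M N : ZdSite d → Fin d → Fin d → ℝ) : div₂ (M + N) = div₂ M + div₂ N := by
  funext y k
  simp only [div₂, Pi.add_apply, ← Finset.sum_add_distrib]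
  exact Finset.sum_congr rfl fun j _ => by ring

/-- `div₂` is homogeneous. [folklore] -/
theorem div₂_smul (a : ℝ) (M : ZdSite d → Fin d → Fin d → ℝ) : div₂ (a • M) = a • div₂ M := by
  funext y k
  simp only [div₂, Pi.smul_apply, smul_eq_mul, Finset.mul_sum, mul_sub]

end LatticeChain

/-! ### The Euclidean space of plaquette fields and its closed subspace -/

section FluxSpace

/-- The Euclidean space of real plaquette fields on the plaquettes of `Λ` (norm `‖S‖² = ∑ₚ Sₚ²`).
[folklore] -/
abbrev FluxSpace (Λ : Finset (ZdSite d)) : Type := EuclideanSpace ℝ ↥(plaquettesIn Λ)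

variable {Λ : Finset (ZdSite d)}

/-- `‖S‖² = ∑ₚ Sₚ²`. [folklore] -/
theorem fluxSpace_norm_sq (S : FluxSpace Λ) : ‖S‖ ^ 2 = ∑ p, S p ^ 2 :=
  EuclideanSpace.real_norm_sq_eq S

variable (Λ) in
/-- The boundary map `c ↦ ∂(fluxChain Λ c)` as a linear map. [folklore] -/
def divFlux : FluxSpace Λ →ₗ[ℝ] (ZdSite d → Fin d → ℝ) where
  toFun S := div₂ (fluxChain Λ (WithLp.ofLp S))
  map_add' S S' := by
    simp only [WithLp.ofLp_add, fluxChain_add, LatticeChain.div₂_add]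
  map_smul' a S := by
    simp only [WithLp.ofLp_smul, fluxChain_smul, LatticeChain.div₂_smul, RingHom.id_apply]

/-- `divFlux Λ S = div₂ (fluxChain Λ S)`. [folklore] -/
theorem divFlux_apply (S : FluxSpace Λ) : divFlux Λ S = div₂ (fluxChain Λ (WithLp.ofLp S)) := rfl

variable (Λ) in
/-- **The closed plaquette fields** `Z(Λ) = {c | ∂(fluxChain Λ c) = 0}`, a subspace of
`FluxSpace Λ`. [cite: FrohlichSpencerCMP1982, §2.4 (2.19)–(2.21) (the constraint δn = 0)] -/
def closedFlux : Submodule ℝ (FluxSpace Λ) := LinearMap.ker (divFlux Λ)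

/-- Membership in `closedFlux`. [folklore] -/
theorem mem_closedFlux {c : FluxSpace Λ} :
    c ∈ closedFlux Λ ↔ div₂ (fluxChain Λ (WithLp.ofLp c)) = 0 :=
  LinearMap.mem_ker

/-- An integer plaquette field satisfies the closed-flux constraint `∑ cₚ ∂p = 0` of
`U1DualFluxEnsemble` iff its real version lies in `closedFlux Λ`. [folklore] -/
theorem toLp_intCast_mem_closedFlux_iff (c : ↥(plaquettesIn Λ) → ℤ) :
    WithLp.toLp 2 (fun p => (c p : ℝ)) ∈ closedFlux Λ ↔ ∑ p, c p • plaqCurrent (p : Plaq d) = 0 := by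
  rw [mem_closedFlux, WithLp.ofLp_toLp, div₂_fluxChain_intCast_eq_zero_iff]

end FluxSpace

/-! ### The Coulomb field `ε_Λ` and the Coulomb energy `(ε_Λ, ε_Λ)` -/

section Coulomb

variable {Λ : Finset (ZdSite d)}

variable (Λ) in
/-- **The Coulomb field** `ε_Λ(S) = S - P_{Z(Λ)} S`: the component of the plaquette field `S`
orthogonal to the closed fields, i.e. the minimal-norm element of `S + Z(Λ)` (Fröhlich–Spencer's
`ε_Λ`, (2.51), for `S` the sheet of a loop). [cite: FrohlichSpencerCMP1982, §2.7 (2.50)–(2.52)] -/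
def coulombField (S : FluxSpace Λ) : FluxSpace Λ := S - (closedFlux Λ).starProjection S

variable (Λ) in
/-- **The Coulomb energy** `(ε_Λ, ε_Λ) = ‖ε_Λ(S)‖²` of a plaquette field in `Λ`.
[cite: FrohlichSpencerCMP1982, §2.7 (2.51)–(2.54), §2.10 (2.88)] -/
def coulombEnergy (S : FluxSpace Λ) : ℝ := ‖coulombField Λ S‖ ^ 2

/-- `ε_Λ(S)` is orthogonal to the closed fields. [cite: FrohlichSpencerCMP1982, §2.7 (2.52) ((dα, ε_Λ) = 0)] -/
theorem coulombField_mem_orthogonal (S : FluxSpace Λ) : coulombField Λ S ∈ (closedFlux Λ)ᗮ :=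
  Submodule.sub_starProjection_mem_orthogonal S

/-- `P_{Z(Λ)} S` is closed. [folklore] -/
theorem starProjection_mem_closedFlux (S : FluxSpace Λ) :
    (closedFlux Λ).starProjection S ∈ closedFlux Λ :=
  Submodule.starProjection_apply_mem _ S

/-- `S = P S + ε_Λ(S)`. [folklore] -/
theorem starProjection_add_coulombField (S : FluxSpace Λ) :
    (closedFlux Λ).starProjection S + coulombField Λ S = S := by
  simp [coulombField]

/-- The Coulomb energy is non-negative. [folklore] -/
theorem coulombEnergy_nonneg (S : FluxSpace Λ) : 0 ≤ coulombEnergy Λ S := sq_nonneg _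

/-- **The exact splitting** (Pythagoras): for a closed field `c`,
`‖c + S‖² = ‖c + P S‖² + (ε_Λ, ε_Λ)` — the flux configuration `c + S` costs the Coulomb energy of
`S` plus the energy of the closed configuration `c + P S`. This is the algebraic core of the
spin-wave factorisation of the Villain model. [cite: FrohlichSpencerCMP1982, §2.7 (2.52)–(2.54)] -/
theorem norm_sq_add_eq_of_mem {c : FluxSpace Λ} (hc : c ∈ closedFlux Λ) (S : FluxSpace Λ) :
    ‖c + S‖ ^ 2 = ‖c + (closedFlux Λ).starProjection S‖ ^ 2 + coulombEnergy Λ S := by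
  have hsplit : c + S = (c + (closedFlux Λ).starProjection S) + coulombField Λ S := by
    simp only [coulombField]; abel
  have hmem : c + (closedFlux Λ).starProjection S ∈ closedFlux Λ :=
    Submodule.add_mem _ hc (starProjection_mem_closedFlux S)
  have horth : @inner ℝ _ _ (c + (closedFlux Λ).starProjection S) (coulombField Λ S) = 0 :=
    Submodule.inner_right_of_mem_orthogonal hmem (coulombField_mem_orthogonal S)
  rw [hsplit, coulombEnergy, sq, sq, sq]
  exact norm_add_sq_eq_norm_sq_add_norm_sq_of_inner_eq_zero _ _ horth

/-- **Variational characterisation**: `(ε_Λ, ε_Λ) ≤ ‖c + S‖²` for every closed `c`.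
[cite: FrohlichSpencerCMP1982, §2.7 (2.51)] -/
theorem coulombEnergy_le_norm_sq_add_of_mem {c : FluxSpace Λ} (hc : c ∈ closedFlux Λ)
    (S : FluxSpace Λ) : coulombEnergy Λ S ≤ ‖c + S‖ ^ 2 := by
  rw [norm_sq_add_eq_of_mem hc S]
  nlinarith [sq_nonneg ‖c + (closedFlux Λ).starProjection S‖]

/-- The minimum is attained at `c = -P S`: `(ε_Λ, ε_Λ) = ‖-P S + S‖²`. [folklore] -/
theorem coulombEnergy_eq_norm_sq_add (S : FluxSpace Λ) :
    coulombEnergy Λ S = ‖-(closedFlux Λ).starProjection S + S‖ ^ 2 := by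
  rw [coulombEnergy, coulombField]
  congr 2
  abel

/-- `(ε_Λ, ε_Λ) ≤ ‖S‖²`. [folklore] -/
theorem coulombEnergy_le_norm_sq (S : FluxSpace Λ) : coulombEnergy Λ S ≤ ‖S‖ ^ 2 := by
  simpa using coulombEnergy_le_norm_sq_add_of_mem (Submodule.zero_mem (closedFlux Λ)) S

/-- Adding a closed field does not change the Coulomb field. [folklore] -/
theorem coulombField_add_of_mem {c : FluxSpace Λ} (hc : c ∈ closedFlux Λ) (S : FluxSpace Λ) :
    coulombField Λ (c + S) = coulombField Λ S := by
  simp only [coulombField, map_add, (Submodule.starProjection_eq_self_iff).2 hc]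
  abel

/-- Adding a closed field does not change the Coulomb energy. [folklore] -/
theorem coulombEnergy_add_of_mem {c : FluxSpace Λ} (hc : c ∈ closedFlux Λ) (S : FluxSpace Λ) :
    coulombEnergy Λ (c + S) = coulombEnergy Λ S := by
  rw [coulombEnergy, coulombEnergy, coulombField_add_of_mem hc]

/-- The splitting in coordinates: `∑ₚ (cₚ + Sₚ)² = ∑ₚ (cₚ + (P S)ₚ)² + (ε_Λ, ε_Λ)` for closed `c`.
[cite: FrohlichSpencerCMP1982, §2.7 (2.52)–(2.54)] -/
theorem sum_sq_add_eq_of_mem {c : FluxSpace Λ} (hc : c ∈ closedFlux Λ) (S : FluxSpace Λ) :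
    ∑ p, (c p + S p) ^ 2 =
      ∑ p, (c p + (closedFlux Λ).starProjection S p) ^ 2 + coulombEnergy Λ S := by
  have h := norm_sq_add_eq_of_mem hc S
  rw [fluxSpace_norm_sq, fluxSpace_norm_sq] at h
  simpa only [PiLp.add_apply] using h

/-- The variational characterisation in coordinates: `(ε_Λ, ε_Λ) ≤ ∑ₚ (cₚ + Sₚ)²` for closed `c`.
[cite: FrohlichSpencerCMP1982, §2.7 (2.51)] -/
theorem coulombEnergy_le_sum_sq_of_mem {c : FluxSpace Λ} (hc : c ∈ closedFlux Λ) (S : FluxSpace Λ) :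
    coulombEnergy Λ S ≤ ∑ p, (c p + S p) ^ 2 := by
  have h := coulombEnergy_le_norm_sq_add_of_mem hc S
  rw [fluxSpace_norm_sq] at h
  simpa only [PiLp.add_apply] using h

/-- The coordinate sum of squares is the pairing `⟪·,·⟫₂` of the 2-chains. [folklore] -/
theorem sum_sq_eq_pair₂_fluxChain (f : ↥(plaquettesIn Λ) → ℝ) :
    ∑ p, f p ^ 2 = pair₂ (fluxChain Λ f) (fluxChain Λ f) :=
  (pair₂_fluxChain_self f).symm

end Coulomb

/-! ### The sheet of a rectangular loop: plaquette field versus tensor -/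

section Sheet

/-- `s • eᵢ = Pi.single i s`. [folklore] -/
theorem zsmul_e (s : ℤ) (i : Fin d) : s • (e i : ZdSite d) = Pi.single i s := by
  funext m
  by_cases hm : m = i
  · subst hm; simp
  · simp [Pi.single_eq_of_ne hm]

/-- The directions of a plaquette of the sheet are `(i, j)`. [folklore] -/
theorem dirs_of_mem_rectPlaqs {x₀ : ZdSite d} {i j : Fin d} {R T : ℕ} {q : Plaq d}
    (hq : q ∈ rectPlaqs x₀ i j R T) : q.2.1 = i ∧ q.2.2 = j := by
  simp only [rectPlaqs, Finset.mem_image] at hq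
  obtain ⟨ts, _, rfl⟩ := hq
  exact ⟨rfl, rfl⟩

/-- A plaquette of the sheet is determined by its base point. [folklore] -/
theorem eq_of_mem_rectPlaqs {x₀ : ZdSite d} {i j : Fin d} {R T : ℕ} {q : Plaq d}
    (hq : q ∈ rectPlaqs x₀ i j R T) : q = (q.1, i, j) := by
  obtain ⟨h1, h2⟩ := dirs_of_mem_rectPlaqs hq
  ext <;> simp [h1, h2]

/-- Base points of the sheet's plaquettes: `(y; i, j)` tiles the rectangle iff
`y = x₀ + s eᵢ + t eⱼ` with `s < R`, `t < T`. [folklore] -/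
theorem mk_mem_rectPlaqs_iff {x₀ y : ZdSite d} {i j : Fin d} {R T : ℕ} :
    (y, i, j) ∈ rectPlaqs x₀ i j R T ↔
      ∃ s < R, ∃ t < T, y = x₀ + (s : ℤ) • e i + (t : ℤ) • e j := by
  simp only [rectPlaqs, Finset.mem_image, Finset.mem_product, Finset.mem_range, Prod.exists,
    Prod.mk.injEq, and_true, zsmul_e]
  constructor
  · rintro ⟨t, s, ⟨ht, hs⟩, h⟩
    exact ⟨s, hs, t, ht, by rw [← h]; abel⟩
  · rintro ⟨s, hs, t, ht, h⟩
    exact ⟨t, s, ⟨ht, hs⟩, by rw [h]; abel⟩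

/-- The rectangle indicator of `U1CoulombSheet` is the indicator of the base points of the sheet's
plaquettes (`i ≠ j`). [folklore] -/
theorem rectInd_eq_ite {x₀ : ZdSite d} {i j : Fin d} (hij : i ≠ j) (R T : ℕ) (y : ZdSite d) :
    rectInd x₀ i j R T y = if (y, i, j) ∈ rectPlaqs x₀ i j R T then 1 else 0 := by
  classical
  rw [if_congr mk_mem_rectPlaqs_iff rfl rfl, rectInd_eq_sum_sum]
  by_cases h : ∃ s < R, ∃ t < T, y = x₀ + (s : ℤ) • e i + (t : ℤ) • e j
  · rw [if_pos h]
    obtain ⟨s₀, hs₀, t₀, ht₀, rfl⟩ := h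
    have hcoord : ∀ s t : ℕ, x₀ + (s₀ : ℤ) • e i + (t₀ : ℤ) • e j = x₀ + (s : ℤ) • e i + (t : ℤ) • e j →
        s = s₀ ∧ t = t₀ := by
      intro s t hst
      have hi := congrFun hst i
      have hj := congrFun hst j
      simp only [zsmul_e, Pi.add_apply, Pi.single_eq_same, Pi.single_eq_of_ne hij,
        Pi.single_eq_of_ne (Ne.symm hij)] at hi hj
      constructor <;> omega
    rw [Finset.sum_eq_single s₀, Finset.sum_eq_single t₀, if_pos rfl]
    · intro t _ ht
      rw [if_neg]
      exact fun hst => ht (hcoord s₀ t hst).2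
    · intro ht; exact absurd (Finset.mem_range.2 ht₀) ht
    · intro s _ hs
      refine Finset.sum_eq_zero fun t _ => ?_
      rw [if_neg]
      exact fun hst => hs (hcoord s t hst).1
    · intro hs; exact absurd (Finset.mem_range.2 hs₀) hs
  · rw [if_neg h]
    refine Finset.sum_eq_zero fun s hs => Finset.sum_eq_zero fun t ht => ?_
    rw [if_neg]
    exact fun hst => h ⟨s, Finset.mem_range.1 hs, t, Finset.mem_range.1 ht, hst⟩

variable {Λ : Finset (ZdSite d)}

/-- **The plaquette field `sheet` of `U1DualFluxEnsemble` is the tensor `sheetT` of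
`U1CoulombSheet`** (for `i < j` and a region containing the rectangle's plaquettes).
[cite: FrohlichSpencerCMP1982, §2.4 (the surface S with ∂S = ℒ), §2.7 (2.49)] -/
theorem fluxChain_sheet {x₀ : ZdSite d} {i j : Fin d} (hij : i < j) {R T : ℕ}
    (hsub : rectPlaqs x₀ i j R T ⊆ plaquettesIn Λ) :
    fluxChain Λ (fun p => (sheet Λ x₀ i j R T p : ℝ)) = sheetT x₀ i j R T := by
  classical
  have hne : i ≠ j := hij.ne
  funext y k l
  -- the left-hand side as a sum over the rectangle's plaquettes
  have hL : fluxChain Λ (fun p => (sheet Λ x₀ i j R T p : ℝ)) y k l =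
      (if (y, k, l) ∈ rectPlaqs x₀ i j R T then (1 : ℝ) else 0) -
        (if (y, l, k) ∈ rectPlaqs x₀ i j R T then (1 : ℝ) else 0) := by
    simp only [fluxChain, sheet, Int.cast_ite, Int.cast_one, Int.cast_zero, ite_mul, one_mul,
      zero_mul]
    rw [Finset.sum_coe_sort (plaquettesIn Λ)
      (fun q : Plaq d => if q ∈ rectPlaqs x₀ i j R T then (plaqChain q y k l : ℝ) else 0),
      Finset.sum_ite_mem, Finset.inter_eq_right.2 hsub]
    simp only [plaqChain, Finset.sum_sub_distrib, Finset.sum_ite_eq]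
  -- membership of reversed / wrongly oriented triples
  have hmem : ∀ k' l', (y, k', l') ∈ rectPlaqs x₀ i j R T →
      k' = i ∧ l' = j := fun k' l' h => dirs_of_mem_rectPlaqs h
  rw [hL, sheetT, rectInd_eq_ite hne, coef]
  by_cases h1 : k = i ∧ l = j
  · obtain ⟨hk, hl⟩ := h1
    subst hk; subst hl
    have hB : (y, l, k) ∉ rectPlaqs x₀ k l R T := fun h => hne (hmem l k h).2
    by_cases hP : (y, k, l) ∈ rectPlaqs x₀ k l R T <;> simp [hP, hB]
  · by_cases h2 : k = j ∧ l = i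
    · obtain ⟨hk, hl⟩ := h2
      subst hk; subst hl
      have hA : (y, k, l) ∉ rectPlaqs x₀ l k R T := fun h => hne (hmem k l h).2
      have hd : ¬(k = l ∧ l = k) := fun h => hne h.2
      by_cases hP : (y, l, k) ∈ rectPlaqs x₀ l k R T <;> simp [hP, hA, hd]
    · have h3 : (y, k, l) ∉ rectPlaqs x₀ i j R T := fun h => h1 (hmem k l h)
      have h4 : (y, l, k) ∉ rectPlaqs x₀ i j R T := fun h => h2 ⟨(hmem l k h).2, (hmem l k h).1⟩
      simp [h1, h2, h3, h4]

end Sheet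

/-! ### Cubes eventually contain every finite configuration -/

section Boxes

/-- Every site lies in all large centred cubes. [folklore] -/
theorem eventually_mem_box (x : ZdSite d) : ∀ᶠ m : ℕ in atTop, x ∈ box d m := by
  refine (eventually_ge_atTop (Finset.univ.sup fun i => (x i).natAbs)).mono fun m hm => ?_
  rw [mem_box]
  intro i
  have hi : (x i).natAbs ≤ m := (Finset.le_sup (f := fun i => (x i).natAbs) (Finset.mem_univ i)).trans hm
  omega

/-- Every finite set of sites lies in all large centred cubes. [folklore] -/
theorem eventually_subset_box (F : Finset (ZdSite d)) : ∀ᶠ m : ℕ in atTop, F ⊆ box d m := by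
  have h : ∀ᶠ m : ℕ in atTop, ∀ x ∈ F, x ∈ box d m :=
    (Filter.eventually_all_finset F).2 fun x _ => eventually_mem_box x
  exact h.mono fun m hm x hx => hm x hx

/-- The plaquettes of a rectangle are plaquettes of all large cubes (`i < j`). [folklore] -/
theorem eventually_rectPlaqs_subset {x₀ : ZdSite d} {i j : Fin d} (hij : i < j) (R T : ℕ) :
    ∀ᶠ m : ℕ in atTop, rectPlaqs x₀ i j R T ⊆ plaquettesIn (box d m) := by
  classical
  -- the finite set of all corners of the rectangle's plaquettes
  set F : Finset (ZdSite d) := (rectPlaqs x₀ i j R T).biUnion fun q =>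
    {q.1, q.1 + Pi.single i 1, q.1 + Pi.single j 1, q.1 + Pi.single i 1 + Pi.single j 1} with hF
  refine (eventually_subset_box F).mono fun m hm q hq => ?_
  have hq' := eq_of_mem_rectPlaqs hq
  rw [hq', Plaq.mem_plaquettesIn]
  have hc : ∀ z ∈ ({q.1, q.1 + Pi.single i 1, q.1 + Pi.single j 1,
      q.1 + Pi.single i 1 + Pi.single j 1} : Finset (ZdSite d)), z ∈ box d m := fun z hz =>
    hm (Finset.mem_biUnion.2 ⟨q, hq, hz⟩)
  exact ⟨hc _ (by simp), hij, hc _ (by simp), hc _ (by simp), hc _ (by simp)⟩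

/-- A finitely supported alternating tensor is, in all large cubes, the 2-chain of its plaquette
field. [folklore] -/
theorem eventually_support_subset {c : ZdSite d → Fin d → Fin d → ℝ} (hfs : HasFiniteSupport c)
    (halt : IsAltR₂ c) :
    ∀ᶠ m : ℕ in atTop, ∀ y k l, c y k l ≠ 0 →
      (y, k, l) ∈ plaquettesIn (box d m) ∨ (y, l, k) ∈ plaquettesIn (box d m) := by
  classical
  set F : Finset (ZdSite d) := hfs.toFinset.biUnion fun y =>
    Finset.univ.biUnion fun kl : Fin d × Fin d =>
      {y, y + Pi.single kl.1 1, y + Pi.single kl.2 1, y + Pi.single kl.1 1 + Pi.single kl.2 1} with hF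
  refine (eventually_subset_box F).mono fun m hm y k l hc => ?_
  have hy : y ∈ hfs.toFinset := by
    rw [Set.Finite.mem_toFinset, Function.mem_support]
    intro h0
    exact hc (by rw [h0]; rfl)
  have hcorner : ∀ k' l' : Fin d, ∀ z ∈ ({y, y + Pi.single k' 1, y + Pi.single l' 1,
      y + Pi.single k' 1 + Pi.single l' 1} : Finset (ZdSite d)), z ∈ box d m := by
    intro k' l' z hz
    exact hm (Finset.mem_biUnion.2 ⟨y, hy, Finset.mem_biUnion.2 ⟨(k', l'), Finset.mem_univ _, hz⟩⟩)
  have hkl : k ≠ l := by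
    rintro rfl
    have h := halt y k k
    exact hc (by linarith)
  rcases lt_or_gt_of_ne hkl with h | h
  · left
    rw [Plaq.mem_plaquettesIn]
    exact ⟨hcorner k l _ (by simp), h, hcorner k l _ (by simp), hcorner k l _ (by simp),
      hcorner k l _ (by simp)⟩
  · right
    rw [Plaq.mem_plaquettesIn]
    refine ⟨hcorner l k _ (by simp), h, hcorner l k _ (by simp), hcorner l k _ (by simp),
      hcorner l k _ (by simp)⟩

end Boxes

/-! ### The perimeter bound for the Coulomb energy of the sheet -/

section Main

variable {n : ℕ}

/-- **The finite-volume Coulomb energy of the sheet of a Wilson loop obeys a perimeter bound,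
uniformly in the volume** (Fröhlich–Spencer's "`(ε_Λ, ε_Λ) ≤ const (L + T)` as `Λ ↗ ℤ⁴`",
asserted after (2.88); here in every dimension `d = n + 1 ≥ 4`): there is `C > 0` such that for
every rectangle — base point `x₀`, plane `i < j`, sides `R, T ≥ 1` — the Coulomb energy of the
sheet `S_γ` (`U1DualFluxEnsemble.sheet`) in the cube `Λ_m = {-m,…,m}^d` satisfies
`(ε_{Λ_m}, ε_{Λ_m}) ≤ C (R + T)` for all sufficiently large `m`. Proof: insert the closed competitor
of `U1CoulombSheetEnergy.exists_closedChain_sheet` into the variational characterisation, once the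
cube contains its support. [cite: FrohlichSpencerCMP1982, §2.10 (2.88) and the sentence following it] -/
theorem coulombEnergy_sheet_le (hn : 3 ≤ n) :
    ∃ C : ℝ, 0 < C ∧ ∀ (x₀ : ZdSite (n + 1)) (i j : Fin (n + 1)), i < j → ∀ R T : ℕ, 1 ≤ R → 1 ≤ T →
      ∀ᶠ m : ℕ in atTop, coulombEnergy (box (n + 1) m)
          (WithLp.toLp 2 fun p => (sheet (box (n + 1) m) x₀ i j R T p : ℝ)) ≤ C * (R + T) := by
  obtain ⟨C, hC, h⟩ := exists_closedChain_sheet hn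
  refine ⟨C, hC, fun x₀ i j hij R T hR hT => ?_⟩
  obtain ⟨c, hfs, halt, hcl, hle⟩ := h x₀ i j hij.ne R T hR hT
  filter_upwards [eventually_rectPlaqs_subset (x₀ := x₀) hij R T,
    eventually_support_subset hfs halt] with m hsub hsupp
  set Λ := box (n + 1) m with hΛ
  -- the closed competitor as an element of the flux space
  set cP : FluxSpace Λ := WithLp.toLp 2 (ofChain Λ c) with hcP
  have hchain : fluxChain Λ (WithLp.ofLp cP) = c := by
    rw [hcP, WithLp.ofLp_toLp]
    exact fluxChain_ofChain halt hsupp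
  have hmem : cP ∈ closedFlux Λ := by
    rw [mem_closedFlux, hchain, hcl]
  set S : FluxSpace Λ := WithLp.toLp 2 fun p => (sheet Λ x₀ i j R T p : ℝ) with hS
  have hsheet : fluxChain Λ (WithLp.ofLp S) = sheetT x₀ i j R T := by
    rw [hS, WithLp.ofLp_toLp]
    exact fluxChain_sheet hij hsub
  calc coulombEnergy Λ S ≤ ∑ p, (cP p + S p) ^ 2 := coulombEnergy_le_sum_sq_of_mem hmem S
    _ = pair₂ (fluxChain Λ (WithLp.ofLp (cP + S))) (fluxChain Λ (WithLp.ofLp (cP + S))) := by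
        rw [← sum_sq_eq_pair₂_fluxChain]
        rfl
    _ = pair₂ (sheetT x₀ i j R T + c) (sheetT x₀ i j R T + c) := by
        rw [WithLp.ofLp_add, fluxChain_add, hchain, hsheet, add_comm c (sheetT x₀ i j R T)]
    _ ≤ C * (R + T) := hle

end Main

end Literature.MathematicalPhysics.QuantumFieldTheory
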